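import Literature.MathematicalPhysics.QuantumFieldTheory.Balaban1983to89.B1Eq324BenfattoSect5TupleClustersDecay
import HarnessLib

/-!
# `Balaban1983to89.B1Eq324BenfattoSect5TupleClustersAnchored` — [BenfattoEtAl1978] Appendix D p. 166 / (5.11) p. 155: the Appendix D
# bound for tuple-class slots with the decay measured FROM THE ANCHOR TESSERA OF ONE SLOT'S OWN TUPLE —
# `|𝓔^T_{z̄}(Y₁,…,Y_k)| ≤ C·Σ_{T_{j₁}} |A^n_Δ|e^{−(ϰ/2)d(Δ)}e^{(δ/2)θ(Δ)}·Π_{j≠j₁} DM_j(Δ₀)`, `DM_j(y)` the mass of slot `j` weighted by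
# `e^{−(δ/2k)·ℓ¹(y, ·)}` — the form for a slot whose tuples are spread over the whole volume (`H^{(l)}` of (5.11), `Ψ₃`, the (5.34) term) — PROVED

statement-level skeleton of published theorems with citation tags; proofs where landed; nothing here is a claim about the
Yang–Mills mass gap

WHY THIS MODULE (cell `pub-ymgap`, seat `dag-n08-c`, node N08; sequel of `…Sect5TupleClustersDecay`).  `…TupleClustersDecay` measures the
decay from a FIXED region met by slot `j₁` (a box core: the CROSS terms).  For the corrections removed INSIDE the free cumulants —
`T₀(Ĥ_J + H^{(l)}; k) − T₀(Ĥ_J; k)` ((5.11) «inside T₀»), `Ψ₃`, the `τ`-term of (5.34) — the small slot's tuples lie ANYWHERE in `J`; the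
extensive bound then measures every other slot's decay from the anchor `Δ₀` of the small slot's own tuple: per tuple colouring the
designated pair is (anchor of `g(j₁)`, anchor of the farthest `g(j)`), «max ≥ mean» splits the decay over the slots, and the colouring
sum factorises CONDITIONALLY on `g(j₁)`.  With the one-point lattice sums of `…Sect5RegionCount` (`R_A = {Δ₀}`) every `DM_j(Δ₀)` is
`O(A)` uniformly in `Δ₀` and in the volume, so the whole bound is `(mass of slot j₁)·O(A)^{k−1}` — for `H^{(l)}` that mass is
`|J|·s₁Ab^De^{−(ϰ/4)w}` by (5.11).

WHAT IS PROVED (theorems only; no definition, no named fact, no `sorry`; axioms standard).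
* ★ `abs_ursellOf_poly_condField_le_anchored` — generic finite-index form with a pair weight `ρ(c₁, c) ≥ 0` such that every non-zero
  colouring has, for every slot `j`, a leg of `f(j₁)` and a leg of `f(j)` at `ℓ¹ ≥ ρ(f(j₁), f(j))`:
  `|𝓔^T_{z̄}| ≤ C·Σ_{c₁}|a_{j₁c₁}|e^{(δ/2)θ_{c₁}}·Π_{j≠j₁}Σ_c|a_{jc}|e^{(δ/2)θ_c}e^{−(δ/(2k))ρ(c₁,c)}`, `C = 2^{kD}2^{2^{kD}}K₀^{kD}`.
* ★★ **`abs_ursellOf_tupleSums_condField_le_anchored`** — tuple-class slots, `ρ = ℓ¹` between anchors: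
  `|𝓔^T_{z̄}(Y₁,…,Y_k)| ≤ C·Σ_{T_{j₁}}|A^n_Δ|e^{−(ϰ/2)d(Δ)}e^{(δ/2)D²(√d·d(Δ)+d)}·Π_{j≠j₁}Σ_{T_j}|A^{n'}_{Δ'}|e^{−(ϰ/2)d(Δ')}e^{(δ/2)D²(√d·d(Δ')+d)}e^{−(δ/(2k))ℓ¹(Δ₀,Δ'₀)}`.
* ★ `abs_ursellOf_tupleSums_condField_le_anchored_of_uniform` — with `DM_j(y) ≤ M_j` for all `y` (`…RegionCount.decayWeighted_classSum_le_card_mul`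
  at `R_A = {y}`): `|𝓔^T_{z̄}(Y₁,…,Y_k)| ≤ C·𝓜̃_{j₁}·Π_{j≠j₁}M_j`.

HONEST SCOPE / NOT HERE.  The application to `H^{(l)}` ((5.11) inside `T₀`), `Ψ₃`, (5.34) and the error collection are separate files;
`BasicLemmaPrinted` stays OPEN.  NOT summit progress; count-neutral for N08; nothing of [Balaban1985UV3] is asserted.
-/

open Finset MeasureTheory
open scoped BigOperators

namespace Literature.MathematicalPhysics.QuantumFieldTheory.Balaban1983to89.B1Eq324BenfattoSect5TupleClustersAnchored

open _root_.MeasureTheory _root_.ProbabilityTheory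
open Literature.Probability.LatticeModels (ursellOf)
open Literature.MathematicalPhysics.QuantumFieldTheory
open Literature.MathematicalPhysics.QuantumFieldTheory.Balaban1983to89.B1Eq324BenfattoLemma
open Literature.MathematicalPhysics.QuantumFieldTheory.Balaban1983to89.B1Eq324BenfattoConnLength (connLength_nonneg)
open Literature.MathematicalPhysics.QuantumFieldTheory.Balaban1983to89.B1Eq324BenfattoSect5Eq511 (term)
open Literature.MathematicalPhysics.QuantumFieldTheory.Balaban1983to89.B1Eq324BenfattoSect5PolyClusters
  (abs_ursellOf_monomials_condField_le_exp ursellOf_poly_eq_sum_colourings integrable_abs_monomial_pow_condField measurable_monomial)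
open Literature.MathematicalPhysics.QuantumFieldTheory.Balaban1983to89.B1Eq324BenfattoAppendixDWick (abs_condCov_le_exp_l1)
open Literature.MathematicalPhysics.QuantumFieldTheory.Balaban1983to89.B1Eq324BenfattoMarkov (isProbabilityMeasure_condField)
open Literature.MathematicalPhysics.QuantumFieldTheory.Balaban1983to89.B1Eq324BenfattoSect5TupleClusters
  (tupleSum_eq_sum_option sum_abs_tcoef_mul_eq card_legs_le_of_mem site_of_mem_legs leg_mem_legs_of_mem l1_site_pseudo
   sum_sum_l1_legs_le appDConst_mono)
open Literature.MathematicalPhysics.QuantumFieldTheory.Balaban1983to89.B1Eq324BenfattoSect5TupleClustersDecay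
  (exp_neg_max_le_prod_exp_neg_mean)

variable {d : ℕ} {α β : ℝ} {s D : ℕ} {ϰ : ℝ} {a : Coef d} {Jr : Finset (B1Eq324BenfattoLemma.Site d)}
variable {σ : Type} [Fintype σ] [DecidableEq σ] [Nonempty σ]

omit [Nonempty σ] in
/-- The colouring sum conditioned on the colour of slot `j₁`: `Σ_{f : f j₁ = c₁} W₀(f j₁)·Π_{j≠j₁} W_j(f j₁, f j) = W₀(c₁)·Π_{j≠j₁}Σ_c W_j(c₁, c)`.
[folklore] -/
private theorem sum_filter_apply_eq_mul_prod {ι : Type*} [Fintype ι] [DecidableEq ι] (W₀ : ι → ℝ) (W : σ → ι → ι → ℝ)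
    (j₁ : σ) (c₁ : ι) :
    ∑ f ∈ (Finset.univ : Finset (σ → ι)).filter (fun f => f j₁ = c₁), W₀ (f j₁) * ∏ j ∈ Finset.univ.erase j₁, W j (f j₁) (f j) =
      W₀ c₁ * ∏ j ∈ Finset.univ.erase j₁, ∑ c, W j c₁ c := by
  classical
  set t : σ → Finset ι := Function.update (fun _ => (Finset.univ : Finset ι)) j₁ {c₁} with ht
  have hfilter : (Finset.univ : Finset (σ → ι)).filter (fun f => f j₁ = c₁) = Fintype.piFinset t := by
    ext f
    simp only [Finset.mem_filter, Finset.mem_univ, true_and, Fintype.mem_piFinset, ht]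
    constructor
    · intro hf j
      by_cases hj : j = j₁
      · subst hj; rw [Function.update_self, Finset.mem_singleton]; exact hf
      · rw [Function.update_of_ne hj]; exact Finset.mem_univ _
    · intro hf
      have := hf j₁
      rwa [Function.update_self, Finset.mem_singleton] at this
  set V : σ → ι → ℝ := Function.update (fun j c => W j c₁ c) j₁ (fun _ => W₀ c₁) with hV
  have hsummand : ∀ f ∈ Fintype.piFinset t, W₀ (f j₁) * ∏ j ∈ Finset.univ.erase j₁, W j (f j₁) (f j) = ∏ j, V j (f j) := by
    intro f hf
    have hf₁ : f j₁ = c₁ := by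
      have := Fintype.mem_piFinset.1 hf j₁
      rwa [ht, Function.update_self, Finset.mem_singleton] at this
    rw [← Finset.mul_prod_erase Finset.univ (fun j => V j (f j)) (Finset.mem_univ j₁)]
    congr 1
    · rw [hV, Function.update_self, hf₁]
    · refine Finset.prod_congr rfl fun j hj => ?_
      rw [hV, Function.update_of_ne (Finset.ne_of_mem_erase hj), hf₁]
  rw [hfilter, Finset.sum_congr rfl hsummand, ← Finset.prod_univ_sum t (fun j c => V j c),
    ← Finset.mul_prod_erase Finset.univ _ (Finset.mem_univ j₁)]
  congr 1
  · rw [ht, Function.update_self, Finset.sum_singleton, hV, Function.update_self]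
  · refine Finset.prod_congr rfl fun j hj => ?_
    rw [ht, Function.update_of_ne (Finset.ne_of_mem_erase hj), hV, Function.update_of_ne (Finset.ne_of_mem_erase hj)]

/-- **APPENDIX D WITH THE DECAY MEASURED FROM SLOT `j₁`'S OWN INDEX, GENERIC FINITE-INDEX FORM**: slots
`Z_j = Σ_c a_{jc}·Π_{l∈J_c} z(x_{cl})` under `P̄` (`d ≥ 1`, `|u| ≤ K₀` on the legs, `K₀ ≥ max(1,C₀₀)`, `≤ D` legs and intra-cluster `ℓ¹` sum
`≤ θ_c` per index, rate `0 ≤ δ ≤ log((2d+α²)/(2d))`), a PAIR weight `ρ(c₁, c) ≥ 0` such that every colouring with non-zero coefficients has,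
for every slot `j`, a leg of `f(j₁)` and a leg of `f(j)` at `ℓ¹` distance `≥ ρ(f(j₁), f(j))`:
`|𝓔^T_{z̄}(Z₁,…,Z_k)| ≤ 2^{kD}2^{2^{kD}}K₀^{kD}·Σ_{c₁}|a_{j₁c₁}|e^{(δ/2)θ_{c₁}}·Π_{j≠j₁}Σ_c|a_{jc}|e^{(δ/2)θ_c}e^{−(δ/(2k))ρ(c₁,c)}` — the
colouring sum factorises conditionally on `f(j₁)`. [cite: BenfattoEtAl1978, Appendix D p.166 and (5.11) p.155] -/
theorem abs_ursellOf_poly_condField_le_anchored {ι : Type*} [Fintype ι] [Nonempty ι] {κ : Type}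
    (hα : 0 < α) (hβ : 0 < β) (hd : 0 < d) (Γ : Finset (B1Eq324BenfattoLemma.Site d)) (zbar : B1Eq324BenfattoLemma.Site d → ℝ)
    (ac : σ → ι → ℝ) (Jm : ι → Finset κ) (xs : ι → κ → B1Eq324BenfattoLemma.Site d) {K₀ : ℝ} (hK₀ : 1 ≤ K₀)
    (hK₀' : freeCov d α β 0 0 ≤ K₀) (hu : ∀ c, ∀ l ∈ Jm c, |condMean (freeCov d α β) Γ zbar (xs c l)| ≤ K₀)
    (hq : ∀ c, (Jm c).card ≤ D) (θ : ι → ℝ)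
    (hθ : ∀ c, ∑ l ∈ Jm c, ∑ l' ∈ Jm c, ∑ jj, |((xs c l jj : ℝ) - (xs c l' jj : ℝ))| ≤ θ c)
    {δ : ℝ} (hδ : 0 ≤ δ) (hδle : δ ≤ Real.log ((2 * d + α ^ 2) / (2 * d)))
    (j₁ : σ) (ρ : ι → ι → ℝ) (hρ0 : ∀ c₁ c, 0 ≤ ρ c₁ c)
    (hsep : ∀ f : σ → ι, (∀ j, ac j (f j) ≠ 0) → ∀ j,
      ∃ l₁ ∈ Jm (f j₁), ∃ l₂ ∈ Jm (f j), ρ (f j₁) (f j) ≤ ∑ jj, |((xs (f j₁) l₁ jj : ℝ) - (xs (f j) l₂ jj : ℝ))|) :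
    |ursellOf (fun P : Finset σ => ∫ z, ∏ j ∈ P, (∑ c, ac j c * ∏ l ∈ Jm c, z (xs c l)) ∂condField d α β Γ zbar) Finset.univ| ≤
      2 ^ (Fintype.card σ * D) * 2 ^ 2 ^ (Fintype.card σ * D) * K₀ ^ (Fintype.card σ * D) *
        ∑ c₁, |ac j₁ c₁| * Real.exp (δ / 2 * θ c₁) *
          ∏ j ∈ Finset.univ.erase j₁, ∑ c, |ac j c| * Real.exp (δ / 2 * θ c) *
            Real.exp (-(δ / (2 * Fintype.card σ) * ρ c₁ c)) := by
  classical
  haveI := isProbabilityMeasure_condField (d := d) hα hβ Γ zbar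
  obtain ⟨h0, hsymm, htri, hnn⟩ := l1_site_pseudo (d := d)
  have hCov : ∀ x y : B1Eq324BenfattoLemma.Site d, |condCov (freeCov d α β) Γ x y| ≤
      K₀ * Real.exp (-(δ * ∑ jj, |((x jj : ℝ) - (y jj : ℝ))|)) := by
    intro x y
    refine (abs_condCov_le_exp_l1 hα hβ hd Γ (fun y : B1Eq324BenfattoLemma.Site d => y) x y).trans ?_
    refine mul_le_mul hK₀' (Real.exp_le_exp.2 ?_) (Real.exp_pos _).le (zero_le_one.trans hK₀)
    have := hnn x y
    nlinarith
  have hm : ∀ (j : σ) (c : ι), AEStronglyMeasurable (fun z : B1Eq324BenfattoLemma.Site d → ℝ => ∏ l ∈ Jm c, z (xs c l))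
      (condField d α β Γ zbar) := fun j c => (measurable_monomial (Jm c) (xs c)).aestronglyMeasurable
  have hint : ∀ (j : σ) (c : ι) (q : ℕ), q ≤ Fintype.card σ →
      Integrable (fun z : B1Eq324BenfattoLemma.Site d → ℝ => |∏ l ∈ Jm c, z (xs c l)| ^ q) (condField d α β Γ zbar) :=
    fun j c q _ => integrable_abs_monomial_pow_condField hα hβ Γ zbar (Jm c) (xs c) q
  rw [ursellOf_poly_eq_sum_colourings (μ := condField d α β Γ zbar) ac
    (fun (_ : σ) (c : ι) (z : B1Eq324BenfattoLemma.Site d → ℝ) => ∏ l ∈ Jm c, z (xs c l)) hm hint]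
  set C := (2 : ℝ) ^ (Fintype.card σ * D) * 2 ^ 2 ^ (Fintype.card σ * D) * K₀ ^ (Fintype.card σ * D) with hC
  have hC0 : 0 ≤ C := by positivity
  have hf : ∀ f : σ → ι,
      |(∏ j, ac j (f j)) * ursellOf (fun P : Finset σ => ∫ z, ∏ j ∈ P, ∏ l ∈ Jm (f j), z (xs (f j) l)
        ∂condField d α β Γ zbar) Finset.univ| ≤
        C * ∏ j, (|ac j (f j)| * Real.exp (δ / 2 * θ (f j)) * Real.exp (-(δ / (2 * Fintype.card σ) * ρ (f j₁) (f j)))) := by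
    intro f
    by_cases hgood : ∀ j, ac j (f j) ≠ 0
    · -- the slot whose chosen index carries the largest weight
      obtain ⟨jm, -, hjm⟩ := Finset.exists_max_image (Finset.univ : Finset σ) (fun j => ρ (f j₁) (f j)) Finset.univ_nonempty
      obtain ⟨l₁, hl₁, l₂, hl₂, hρM⟩ := hsep f hgood jm
      have hAD := abs_ursellOf_monomials_condField_le_exp hα hβ Γ zbar (fun j => Jm (f j)) (fun j => xs (f j))
        (fun x y : B1Eq324BenfattoLemma.Site d => ∑ jj, |((x jj : ℝ) - (y jj : ℝ))|) h0 hsymm htri hnn hK₀ hδ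
        (fun j l hl => hu (f j) l hl) (fun j j' l _ l' _ => hCov (xs (f j) l) (xs (f j') l')) hl₁ hl₂
      have hN : ∑ j, (Jm (f j)).card ≤ Fintype.card σ * D := by
        calc ∑ j, (Jm (f j)).card ≤ ∑ _j : σ, D := Finset.sum_le_sum fun j _ => hq (f j)
          _ = Fintype.card σ * D := by rw [Finset.sum_const, smul_eq_mul, Finset.card_univ]
      have hI : ∑ j, ∑ l ∈ Jm (f j), ∑ l' ∈ Jm (f j), (∑ jj, |((xs (f j) l jj : ℝ) - (xs (f j) l' jj : ℝ))|) ≤ ∑ j, θ (f j) :=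
        Finset.sum_le_sum fun j _ => hθ (f j)
      have hmax := exp_neg_max_le_prod_exp_neg_mean (σ := σ) hδ (fun j => ρ (f j₁) (f j)) fun j => hjm j (Finset.mem_univ j)
      have hexp : Real.exp (-(δ / 2 * ((∑ jj, |((xs (f j₁) l₁ jj : ℝ) - (xs (f jm) l₂ jj : ℝ))|) -
          ∑ j, ∑ l ∈ Jm (f j), ∑ l' ∈ Jm (f j), ∑ jj, |((xs (f j) l jj : ℝ) - (xs (f j) l' jj : ℝ))|))) ≤
          (∏ j, Real.exp (-(δ / (2 * Fintype.card σ) * ρ (f j₁) (f j)))) * ∏ j, Real.exp (δ / 2 * θ (f j)) := by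
        refine le_trans ?_ (mul_le_mul_of_nonneg_right hmax (Finset.prod_nonneg fun j _ => (Real.exp_pos _).le))
        rw [← Real.exp_sum, ← Real.exp_add, Real.exp_le_exp, ← Finset.mul_sum]
        nlinarith
      rw [abs_mul, Finset.abs_prod]
      calc (∏ j, |ac j (f j)|) * |ursellOf (fun P : Finset σ => ∫ z, ∏ j ∈ P, ∏ l ∈ Jm (f j), z (xs (f j) l)
              ∂condField d α β Γ zbar) Finset.univ|
          ≤ (∏ j, |ac j (f j)|) * (C * ((∏ j, Real.exp (-(δ / (2 * Fintype.card σ) * ρ (f j₁) (f j)))) *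
              ∏ j, Real.exp (δ / 2 * θ (f j)))) := by
            refine mul_le_mul_of_nonneg_left (hAD.trans ?_) (Finset.prod_nonneg fun j _ => abs_nonneg _)
            calc (2 : ℝ) ^ (∑ j, (Jm (f j)).card) * 2 ^ 2 ^ (∑ j, (Jm (f j)).card) * (K₀ ^ (∑ j, (Jm (f j)).card) *
                  Real.exp (-(δ / 2 * ((∑ jj, |((xs (f j₁) l₁ jj : ℝ) - (xs (f jm) l₂ jj : ℝ))|) -
                    ∑ j, ∑ l ∈ Jm (f j), ∑ l' ∈ Jm (f j), ∑ jj, |((xs (f j) l jj : ℝ) - (xs (f j) l' jj : ℝ))|))))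
                = (2 : ℝ) ^ (∑ j, (Jm (f j)).card) * 2 ^ 2 ^ (∑ j, (Jm (f j)).card) * K₀ ^ (∑ j, (Jm (f j)).card) *
                  Real.exp (-(δ / 2 * ((∑ jj, |((xs (f j₁) l₁ jj : ℝ) - (xs (f jm) l₂ jj : ℝ))|) -
                    ∑ j, ∑ l ∈ Jm (f j), ∑ l' ∈ Jm (f j), ∑ jj, |((xs (f j) l jj : ℝ) - (xs (f j) l' jj : ℝ))|))) := by
                  ring
              _ ≤ C * ((∏ j, Real.exp (-(δ / (2 * Fintype.card σ) * ρ (f j₁) (f j)))) * ∏ j, Real.exp (δ / 2 * θ (f j))) :=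
                  mul_le_mul (appDConst_mono hK₀ hN) hexp (Real.exp_pos _).le hC0
        _ = C * ∏ j, (|ac j (f j)| * Real.exp (δ / 2 * θ (f j)) * Real.exp (-(δ / (2 * Fintype.card σ) * ρ (f j₁) (f j)))) := by
            rw [Finset.prod_mul_distrib, Finset.prod_mul_distrib]; ring
    · obtain ⟨j, hj⟩ := not_forall.1 hgood
      have hj : ac j (f j) = 0 := not_ne_iff.1 hj
      have hprod : ∏ j, ac j (f j) = 0 := Finset.prod_eq_zero (Finset.mem_univ j) hj
      have hprod' : ∏ j, (|ac j (f j)| * Real.exp (δ / 2 * θ (f j)) * Real.exp (-(δ / (2 * Fintype.card σ) * ρ (f j₁) (f j)))) = 0 :=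
        Finset.prod_eq_zero (Finset.mem_univ j) (by rw [hj, abs_zero, zero_mul, zero_mul])
      rw [hprod, zero_mul, abs_zero, hprod', mul_zero]
  -- drop the weight of slot `j₁` itself and factorise the colouring sum conditionally on `f j₁`
  set W : σ → ι → ι → ℝ := fun j c₁ c =>
    |ac j c| * Real.exp (δ / 2 * θ c) * Real.exp (-(δ / (2 * Fintype.card σ) * ρ c₁ c)) with hW
  set W₀ : ι → ℝ := fun c => |ac j₁ c| * Real.exp (δ / 2 * θ c) with hW₀
  have hf' : ∀ f : σ → ι,
      |(∏ j, ac j (f j)) * ursellOf (fun P : Finset σ => ∫ z, ∏ j ∈ P, ∏ l ∈ Jm (f j), z (xs (f j) l)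
        ∂condField d α β Γ zbar) Finset.univ| ≤ C * (W₀ (f j₁) * ∏ j ∈ Finset.univ.erase j₁, W j (f j₁) (f j)) := by
    intro f
    refine (hf f).trans (mul_le_mul_of_nonneg_left ?_ hC0)
    rw [← Finset.mul_prod_erase Finset.univ _ (Finset.mem_univ j₁)]
    refine mul_le_mul_of_nonneg_right ?_ (Finset.prod_nonneg fun j _ =>
      mul_nonneg (mul_nonneg (abs_nonneg _) (Real.exp_pos _).le) (Real.exp_pos _).le)
    have h1 : Real.exp (-(δ / (2 * Fintype.card σ) * ρ (f j₁) (f j₁))) ≤ 1 := by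
      rw [Real.exp_le_one_iff, neg_nonpos]; exact mul_nonneg (by positivity) (hρ0 _ _)
    calc |ac j₁ (f j₁)| * Real.exp (δ / 2 * θ (f j₁)) * Real.exp (-(δ / (2 * Fintype.card σ) * ρ (f j₁) (f j₁)))
        ≤ |ac j₁ (f j₁)| * Real.exp (δ / 2 * θ (f j₁)) * 1 :=
          mul_le_mul_of_nonneg_left h1 (mul_nonneg (abs_nonneg _) (Real.exp_pos _).le)
      _ = W₀ (f j₁) := mul_one _
  refine (Finset.abs_sum_le_sum_abs _ _).trans ((Finset.sum_le_sum fun f _ => hf' f).trans (le_of_eq ?_))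
  rw [← Finset.mul_sum, ← Finset.sum_fiberwise (Finset.univ : Finset (σ → ι)) (fun f => f j₁)
    (fun f => W₀ (f j₁) * ∏ j ∈ Finset.univ.erase j₁, W j (f j₁) (f j))]
  congr 1
  exact Finset.sum_congr rfl fun c₁ _ => sum_filter_apply_eq_mul_prod W₀ W j₁ c₁


/-- **APPENDIX D WITH THE DECAY MEASURED FROM THE ANCHOR OF SLOT `j₁`'S TUPLE, TUPLE-CLASS FORM**: slots
`Y_j = Σ_pΣ_{Δ∈T_j p}Σ_n A^n_Δ e^{−(ϰ/2)d(Δ)} Π z_{Δᵢ}^{nᵢ}` under `P̄(dz|z̄_Γ)` (`d ≥ 1`, `|u| ≤ K₀` on the tuples' tesserae,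
`K₀ ≥ max(1, C₀₀)`, rate `0 ≤ δ ≤ log((2d+α²)/(2d))`), for ANY slot `j₁` (no localisation hypothesis):
`|𝓔^T_{z̄}(Y₁,…,Y_k)| ≤ 2^{kD}2^{2^{kD}}K₀^{kD}·Σ_{T_{j₁}}|A^n_Δ|e^{−(ϰ/2)d(Δ)}e^{(δ/2)D²(√d·d(Δ)+d)}·Π_{j≠j₁}Σ_{T_j}|A^{n'}_{Δ'}|e^{−(ϰ/2)d(Δ')}e^{(δ/2)D²(√d·d(Δ')+d)}e^{−(δ/(2k))ℓ¹(Δ₀,Δ'₀)}`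
(`Δ₀, Δ'₀` the anchor tesserae) — every other slot's mass is weighted by its decay from the anchor of slot `j₁`'s tuple, so the bound is
`(mass of slot j₁)·Π_{j≠j₁}sup_y DM_j(y)` with `DM_j(y) = O(A)` uniformly (`…RegionCount` at `R_A = {y}`).
[cite: BenfattoEtAl1978, Appendix D p.166 and (5.11) p.155] -/
theorem abs_ursellOf_tupleSums_condField_le_anchored (hα : 0 < α) (hβ : 0 < β) (hd : 0 < d)
    (Γ : Finset (B1Eq324BenfattoLemma.Site d)) (zbar : B1Eq324BenfattoLemma.Site d → ℝ)
    (T : σ → (p : ℕ) → Finset (Fin p → Jr)) {K₀ : ℝ} (hK₀ : 1 ≤ K₀) (hK₀' : freeCov d α β 0 0 ≤ K₀)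
    (hu : ∀ j, ∀ p ∈ Finset.Icc 1 s, ∀ Δ ∈ T j p, ∀ i,
      |condMean (freeCov d α β) Γ zbar (Δ i : B1Eq324BenfattoLemma.Site d)| ≤ K₀)
    {δ : ℝ} (hδ : 0 ≤ δ) (hδle : δ ≤ Real.log ((2 * d + α ^ 2) / (2 * d))) (j₁ : σ) :
    |ursellOf (fun P : Finset σ => ∫ z, ∏ j ∈ P,
        (∑ p ∈ Finset.Icc 1 s, ∑ Δ ∈ T j p, ∑ n ∈ admissible p D, term ϰ a z p Δ n) ∂condField d α β Γ zbar) Finset.univ| ≤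
      2 ^ (Fintype.card σ * D) * 2 ^ 2 ^ (Fintype.card σ * D) * K₀ ^ (Fintype.card σ * D) *
        ∑ p₁ ∈ Finset.Icc 1 s, ∑ Δ₁ ∈ T j₁ p₁, ∑ n₁ ∈ admissible p₁ D,
          |a p₁ (fun i => (Δ₁ i : B1Eq324BenfattoLemma.Site d)) n₁| *
            Real.exp (-(ϰ / 2) * connLength fun i => (Δ₁ i : B1Eq324BenfattoLemma.Site d)) *
            Real.exp (δ / 2 * ((D : ℝ) ^ 2 * (Real.sqrt d * connLength (fun i => (Δ₁ i : B1Eq324BenfattoLemma.Site d)) + d))) *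
          ∏ j ∈ Finset.univ.erase j₁, ∑ p ∈ Finset.Icc 1 s, ∑ Δ ∈ T j p, ∑ n ∈ admissible p D,
            |a p (fun i => (Δ i : B1Eq324BenfattoLemma.Site d)) n| *
              Real.exp (-(ϰ / 2) * connLength fun i => (Δ i : B1Eq324BenfattoLemma.Site d)) *
              (Real.exp (δ / 2 * ((D : ℝ) ^ 2 * (Real.sqrt d * connLength (fun i => (Δ i : B1Eq324BenfattoLemma.Site d)) + d))) *
                Real.exp (-(δ / (2 * Fintype.card σ) * ∑ jj,
                  |(((if h : 0 < p₁ then (Δ₁ ⟨0, h⟩ : B1Eq324BenfattoLemma.Site d) else (0 : B1Eq324BenfattoLemma.Site d)) jj : ℝ) -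
                    ((if h : 0 < p then (Δ ⟨0, h⟩ : B1Eq324BenfattoLemma.Site d) else (0 : B1Eq324BenfattoLemma.Site d)) jj : ℝ))|))) := by
  classical
  simp_rw [tupleSum_eq_sum_option T]
  obtain ⟨-, -, -, hnn⟩ := l1_site_pseudo (d := d)
  have hmem : ∀ c : ↥((Finset.Icc 1 s).sigma fun p =>
      (Finset.univ.filter fun Δ : Fin p → Jr => ∃ j', Δ ∈ T j' p) ×ˢ admissible p D),
      c.1.1 ∈ Finset.Icc 1 s ∧ (∃ j', c.1.2.1 ∈ T j' c.1.1) ∧ c.1.2.2 ∈ admissible c.1.1 D := by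
    intro c
    have h := Finset.mem_sigma.1 c.2
    have h2 := Finset.mem_product.1 h.2
    exact ⟨h.1, (Finset.mem_filter.1 h2.1).2, h2.2⟩
  have hpos : ∀ c : ↥((Finset.Icc 1 s).sigma fun p =>
      (Finset.univ.filter fun Δ : Fin p → Jr => ∃ j', Δ ∈ T j' p) ×ˢ admissible p D), 0 < c.1.1 :=
    fun c => (Finset.mem_Icc.1 (hmem c).1).1
  -- anchor of an encoded index (`0` for the dummy index `none`)
  set anc : Option ↥((Finset.Icc 1 s).sigma fun p =>
      (Finset.univ.filter fun Δ : Fin p → Jr => ∃ j', Δ ∈ T j' p) ×ˢ admissible p D) → B1Eq324BenfattoLemma.Site d :=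
    fun c => c.elim 0 fun c => (c.1.2.1 ⟨0, hpos c⟩ : B1Eq324BenfattoLemma.Site d) with hanc
  refine (abs_ursellOf_poly_condField_le_anchored (D := D) hα hβ hd Γ zbar _ _ _ hK₀ hK₀' ?_ ?_
    (fun c : Option ↥((Finset.Icc 1 s).sigma fun p =>
        (Finset.univ.filter fun Δ : Fin p → Jr => ∃ j', Δ ∈ T j' p) ×ˢ admissible p D) => c.elim 0 fun c =>
      (D : ℝ) ^ 2 * (Real.sqrt d * connLength (fun i => (c.1.2.1 i : B1Eq324BenfattoLemma.Site d)) + d)) ?_ hδ hδle j₁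
    (fun c₁ c => ∑ jj, |((anc c₁ jj : ℝ) - (anc c jj : ℝ))|) (fun c₁ c => hnn _ _) ?_).trans (le_of_eq ?_)
  · rintro (_ | c) l hl
    · simp only [Option.elim_none, Finset.notMem_empty] at hl
    · simp only [Option.elim_some] at hl ⊢
      obtain ⟨i, hi⟩ := site_of_mem_legs (Jr := Jr) (Δ := c.1.2.1) hl
      obtain ⟨hp, ⟨j', hj'⟩, -⟩ := hmem c
      rw [hi]; exact hu j' _ hp _ hj' i
  · rintro (_ | c)
    · simp only [Option.elim_none, Finset.card_empty]; exact Nat.zero_le _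
    · simp only [Option.elim_some]; exact card_legs_le_of_mem (hmem c).2.2
  · rintro (_ | c)
    · simp only [Option.elim_none, Finset.sum_empty]; exact le_rfl
    · simp only [Option.elim_some]
      exact sum_sum_l1_legs_le (D := D) c.1.2.1 (hmem c).2.2
  · intro f hf j
    have hcls : ∀ j, ∃ c, f j = some c ∧ c.1.2.1 ∈ T j c.1.1 := by
      intro j
      have h := hf j
      rcases hfj : f j with _ | c
      · rw [hfj] at h; exact absurd rfl h
      · rw [hfj] at h
        simp only [Option.elim_some] at h
        by_cases hc : c.1.2.1 ∈ T j c.1.1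
        · exact ⟨c, rfl, hc⟩
        · exact absurd (if_neg hc) h
    obtain ⟨c₁, hc₁, -⟩ := hcls j₁
    obtain ⟨c₂, hc₂, -⟩ := hcls j
    refine ⟨(((⟨0, hpos c₁⟩ : Fin c₁.1.1) : ℕ), 0), ?_, (((⟨0, hpos c₂⟩ : Fin c₂.1.1) : ℕ), 0), ?_, ?_⟩
    · rw [hc₁]; exact leg_mem_legs_of_mem (hmem c₁).2.2 ⟨0, hpos c₁⟩
    · rw [hc₂]; exact leg_mem_legs_of_mem (hmem c₂).2.2 ⟨0, hpos c₂⟩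
    · rw [hc₁, hc₂]
      simp only [hanc, Option.elim_some]
      rw [dif_pos (hpos c₁), dif_pos (hpos c₂)]
  · -- identify the two index sums with the displayed tuple sums
    congr 1
    rw [Fintype.sum_option]
    simp only [Option.elim_none, abs_zero, zero_mul, zero_add]
    have h₁ := sum_abs_tcoef_mul_eq (s := s) (D := D) (ϰ := ϰ) (a := a) T j₁
      (fun c₁ => Real.exp (δ / 2 * ((D : ℝ) ^ 2 * (Real.sqrt d * connLength (fun i => (c₁.2.1 i : B1Eq324BenfattoLemma.Site d)) + d))) *
        ∏ j ∈ Finset.univ.erase j₁, ∑ p ∈ Finset.Icc 1 s, ∑ Δ ∈ T j p, ∑ n ∈ admissible p D,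
            |a p (fun i => (Δ i : B1Eq324BenfattoLemma.Site d)) n| *
              Real.exp (-(ϰ / 2) * connLength fun i => (Δ i : B1Eq324BenfattoLemma.Site d)) *
              (Real.exp (δ / 2 * ((D : ℝ) ^ 2 * (Real.sqrt d * connLength (fun i => (Δ i : B1Eq324BenfattoLemma.Site d)) + d))) *
                Real.exp (-(δ / (2 * Fintype.card σ) * ∑ jj,
                  |(((if h : 0 < c₁.1 then (c₁.2.1 ⟨0, h⟩ : B1Eq324BenfattoLemma.Site d)
                      else (0 : B1Eq324BenfattoLemma.Site d)) jj : ℝ) -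
                    ((if h : 0 < p then (Δ ⟨0, h⟩ : B1Eq324BenfattoLemma.Site d)
                      else (0 : B1Eq324BenfattoLemma.Site d)) jj : ℝ))|))))
    refine Eq.trans (Finset.sum_congr rfl fun c₁ _ => ?_) (h₁.trans (Finset.sum_congr rfl fun p₁ _ =>
      Finset.sum_congr rfl fun Δ₁ _ => Finset.sum_congr rfl fun n₁ _ => by rw [← mul_assoc]))
    simp only [Option.elim_some]
    rw [mul_assoc]
    congr 1
    congr 1
    refine Finset.prod_congr rfl fun j _ => ?_
    rw [Fintype.sum_option]
    simp only [Option.elim_none, abs_zero, zero_mul, zero_add]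
    have h₂ := sum_abs_tcoef_mul_eq (s := s) (D := D) (ϰ := ϰ) (a := a) T j
      (fun c => Real.exp (δ / 2 * ((D : ℝ) ^ 2 * (Real.sqrt d * connLength (fun i => (c.2.1 i : B1Eq324BenfattoLemma.Site d)) + d))) *
        Real.exp (-(δ / (2 * Fintype.card σ) * ∑ jj,
          |(((if h : 0 < c₁.1.1 then (c₁.1.2.1 ⟨0, h⟩ : B1Eq324BenfattoLemma.Site d)
              else (0 : B1Eq324BenfattoLemma.Site d)) jj : ℝ) -
            ((if h : 0 < c.1 then (c.2.1 ⟨0, h⟩ : B1Eq324BenfattoLemma.Site d)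
              else (0 : B1Eq324BenfattoLemma.Site d)) jj : ℝ))|)))
    refine Eq.trans (Finset.sum_congr rfl fun c _ => ?_) h₂
    simp only [hanc, Option.elim_some]
    rw [dif_pos (hpos c₁), dif_pos (hpos c), mul_assoc]

/-- **THE UNIFORM FORM**: if every other slot's anchor-weighted mass is bounded uniformly in the anchor, `DM_j(y) ≤ M_j` for all `y`
(`…RegionCount.decayWeighted_classSum_le_card_mul` at `R_A = {y}` gives `M_j = A·e^{(δ/2)D²d}·K(δ/2k,d)·Σ_p|admissible p D|·K'^{p−1}`), then
`|𝓔^T_{z̄}(Y₁,…,Y_k)| ≤ 2^{kD}2^{2^{kD}}K₀^{kD}·𝓜̃_{j₁}·Π_{j≠j₁}M_j`, `𝓜̃_{j₁} = Σ_{T_{j₁}}|A^n_Δ|e^{−(ϰ/2)d(Δ)}e^{(δ/2)D²(√d·d(Δ)+d)}` — the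
mass of the SMALL slot times `O(A)^{k−1}`, extensive through `𝓜̃_{j₁}` only. [cite: BenfattoEtAl1978, Appendix D p.166 and (5.11) p.155] -/
theorem abs_ursellOf_tupleSums_condField_le_anchored_of_uniform (hα : 0 < α) (hβ : 0 < β) (hd : 0 < d)
    (Γ : Finset (B1Eq324BenfattoLemma.Site d)) (zbar : B1Eq324BenfattoLemma.Site d → ℝ)
    (T : σ → (p : ℕ) → Finset (Fin p → Jr)) {K₀ : ℝ} (hK₀ : 1 ≤ K₀) (hK₀' : freeCov d α β 0 0 ≤ K₀)
    (hu : ∀ j, ∀ p ∈ Finset.Icc 1 s, ∀ Δ ∈ T j p, ∀ i,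
      |condMean (freeCov d α β) Γ zbar (Δ i : B1Eq324BenfattoLemma.Site d)| ≤ K₀)
    {δ : ℝ} (hδ : 0 ≤ δ) (hδle : δ ≤ Real.log ((2 * d + α ^ 2) / (2 * d))) (j₁ : σ) (M : σ → ℝ)
    (hM : ∀ j, j ≠ j₁ → ∀ y : B1Eq324BenfattoLemma.Site d,
      ∑ p ∈ Finset.Icc 1 s, ∑ Δ ∈ T j p, ∑ n ∈ admissible p D,
        |a p (fun i => (Δ i : B1Eq324BenfattoLemma.Site d)) n| *
          Real.exp (-(ϰ / 2) * connLength fun i => (Δ i : B1Eq324BenfattoLemma.Site d)) *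
          (Real.exp (δ / 2 * ((D : ℝ) ^ 2 * (Real.sqrt d * connLength (fun i => (Δ i : B1Eq324BenfattoLemma.Site d)) + d))) *
            Real.exp (-(δ / (2 * Fintype.card σ) * ∑ jj, |((y jj : ℝ) -
              ((if h : 0 < p then (Δ ⟨0, h⟩ : B1Eq324BenfattoLemma.Site d) else (0 : B1Eq324BenfattoLemma.Site d)) jj : ℝ))|))) ≤ M j) :
    |ursellOf (fun P : Finset σ => ∫ z, ∏ j ∈ P,
        (∑ p ∈ Finset.Icc 1 s, ∑ Δ ∈ T j p, ∑ n ∈ admissible p D, term ϰ a z p Δ n) ∂condField d α β Γ zbar) Finset.univ| ≤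
      2 ^ (Fintype.card σ * D) * 2 ^ 2 ^ (Fintype.card σ * D) * K₀ ^ (Fintype.card σ * D) *
        (∑ p₁ ∈ Finset.Icc 1 s, ∑ Δ₁ ∈ T j₁ p₁, ∑ n₁ ∈ admissible p₁ D,
          |a p₁ (fun i => (Δ₁ i : B1Eq324BenfattoLemma.Site d)) n₁| *
            Real.exp (-(ϰ / 2) * connLength fun i => (Δ₁ i : B1Eq324BenfattoLemma.Site d)) *
            Real.exp (δ / 2 * ((D : ℝ) ^ 2 * (Real.sqrt d * connLength (fun i => (Δ₁ i : B1Eq324BenfattoLemma.Site d)) + d)))) *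
        ∏ j ∈ Finset.univ.erase j₁, M j := by
  refine (abs_ursellOf_tupleSums_condField_le_anchored (D := D) (ϰ := ϰ) (a := a) hα hβ hd Γ zbar T hK₀ hK₀' hu hδ hδle j₁).trans ?_
  rw [mul_assoc _ (∑ p₁ ∈ Finset.Icc 1 s, _) (∏ j ∈ Finset.univ.erase j₁, M j), Finset.sum_mul]
  refine mul_le_mul_of_nonneg_left ?_ (by positivity)
  simp_rw [Finset.sum_mul]
  refine Finset.sum_le_sum fun p₁ hp₁ => Finset.sum_le_sum fun Δ₁ _ => Finset.sum_le_sum fun n₁ _ => ?_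
  refine mul_le_mul_of_nonneg_left (Finset.prod_le_prod (fun j _ => Finset.sum_nonneg fun p _ => Finset.sum_nonneg fun Δ _ =>
    Finset.sum_nonneg fun n _ => mul_nonneg (mul_nonneg (abs_nonneg _) (Real.exp_pos _).le)
      (mul_nonneg (Real.exp_pos _).le (Real.exp_pos _).le)) fun j hj => ?_)
    (mul_nonneg (mul_nonneg (abs_nonneg _) (Real.exp_pos _).le) (Real.exp_pos _).le)
  exact hM j (Finset.ne_of_mem_erase hj) _

end Literature.MathematicalPhysics.QuantumFieldTheory.Balaban1983to89.B1Eq324BenfattoSect5TupleClustersAnchored
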